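import Mathlib
import HarnessLib

/-!
# Integral closure of a pinching: `𝔭 N₁` is integral over `O`, and `f(b) ∈` (integral over `O`) with `f`
# monic forces `b` integral over `O` (crux `WildQuotients.WildQuotientResolution`, stub `stub_phaseZeroHighDim`:
# step (P8'b) of the port of (H1))

Crux stmt-ResolutionOfSingularities-15640 (`WildQuotientResolution`), registered stub `stub_phaseZeroHighDim`,
residual (H1) = Abbes–Saito 2011 Prop. 2.22. In the Zariski-local form of its Lemma 2.21 (evidence memo
PHASE0-H1-PORTPLAN.md §2b) the chain ring `O = O_ξ` is a PINCHING (✓`PrevaluativeRing`: `O ⊆ R₁ = O_𝔭`,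
`𝔭 = 𝔭R₁ ⊆ O`, `O/𝔭` a valuation ring of `R₁/𝔭`), and one needs the integral closure `N` of `O` in the
function field `L` in terms of the integral closure `N₁` of `R₁`:
`N = {b ∈ N₁ : b mod 𝔭N₁ is integral over O/𝔭}`. This file proves the two ring-theoretic facts behind `⊇`
(the inclusion `⊆` is trivial), for subrings `O ≤ R₁` of a commutative ring `L` and an ideal `𝔭` of `R₁`
contained in `O`:

* `isIntegral_mul_of_mem` — **`𝔭 · N₁ ⊆ N`**: if `p ∈ 𝔭` and `n ∈ L` is integral over `R₁` then `p n` is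
  integral over `O` (the equation of `n` with roots scaled by `p`, Mathlib `Polynomial.scaleRoots`, has its
  lower coefficients in `𝔭 ⊆ O`, so it descends to `O[X]` by `Polynomial.lifts_and_natDegree_eq_and_monic`);
  `isIntegral_sum_mul_of_mem` — hence so is every `Σ pᵢ nᵢ`;
* `isIntegral_of_monic_of_aeval` — **if `f ∈ O[X]` is monic of positive degree and `f(b)` is integral over
  `O`, then `b` is integral over `O`** (`b` is a root of the monic `f − f(b)` over `O[f(b)]`, which is
  integral over `O`; transitivity of integrality).

Together: an element `b ∈ N₁` whose class modulo `𝔭N₁` satisfies a monic equation over `O/𝔭` — lift it to a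
monic `f ∈ O[X]` with `f(b) ∈ 𝔭N₁` — is integral over `O`.

[OURS · crux stmt-ResolutionOfSingularities-15640 · helper toward `stub_phaseZeroHighDim` (step P8'b of the port of
the named fact (H1); NOT a proof of the stub); counted 0; AI-level work, weaker than expert review.]
(classical commutative algebra) [folklore]
-/

-- single-problem summit: the doubled namespace component `ResolutionOfSingularities` is forced
set_option linter.dupNamespace false

noncomputable section

open Polynomial

namespace Summit.ResolutionOfSingularities.ResolutionOfSingularities.Theorems.WildQuotientResolution.PinchingIntegral

universe u

variable {L : Type u} [CommRing L] {O R₁ : Subring L} (hOR : O ≤ R₁) {𝔭 : Ideal R₁}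
  (h𝔭 : ∀ p ∈ 𝔭, (p : L) ∈ O)

include hOR h𝔭 in
/-- **`𝔭 · N₁ ⊆ N`**: for `p ∈ 𝔭` (an ideal of `R₁` contained in the subring `O ≤ R₁`) and `n` integral over
`R₁`, the product `p n` is integral over `O`. [folklore] -/
theorem isIntegral_mul_of_mem {p : R₁} (hp : p ∈ 𝔭) {n : L} (hn : IsIntegral R₁ n) :
    IsIntegral O ((p : L) * n) := by
  obtain ⟨g, hg, hgn⟩ := hn
  -- the scaled equation `Q = scaleRoots g p`, monic over `R₁`, with root `p n`
  let Q : R₁[X] := g.scaleRoots p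
  have hQmonic : Q.Monic := (monic_scaleRoots_iff p).mpr hg
  have hQroot : aeval ((p : L) * n) Q = 0 := by
    have := scaleRoots_aeval_eq_zero (r := p) (show aeval n g = 0 from hgn)
    exact this
  -- its coefficients lie in `O`
  let ι : O →+* R₁ := Subring.inclusion hOR
  have hlifts : Q ∈ Polynomial.lifts ι := by
    rw [lifts_iff_coeff_lifts]
    intro i
    rw [coeff_scaleRoots]
    by_cases hi : i < g.natDegree
    · have hmem : g.coeff i * p ^ (g.natDegree - i) ∈ 𝔭 :=
        Ideal.mul_mem_left _ _ (Ideal.pow_mem_of_mem _ hp _ (Nat.sub_pos_of_lt hi))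
      exact ⟨⟨_, h𝔭 _ hmem⟩, Subtype.ext rfl⟩
    · rcases (not_lt.mp hi).eq_or_lt with h | h
      · rw [← h, Nat.sub_self, pow_zero, mul_one, hg.coeff_natDegree]
        exact ⟨1, map_one ι⟩
      · rw [coeff_eq_zero_of_natDegree_lt h, zero_mul]
        exact ⟨0, map_zero ι⟩
  obtain ⟨q, hqQ, -, hqmonic⟩ := lifts_and_natDegree_eq_and_monic hlifts hQmonic
  refine ⟨q, hqmonic, ?_⟩
  have halg : (algebraMap R₁ L).comp ι = algebraMap O L := RingHom.ext fun _ => rfl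
  rw [← halg, ← eval₂_map, hqQ]
  exact hQroot

include hOR h𝔭 in
/-- Finite sums `Σ pᵢ nᵢ` with `pᵢ ∈ 𝔭`, `nᵢ` integral over `R₁`, are integral over `O`. [folklore] -/
theorem isIntegral_sum_mul_of_mem {ι : Type*} (s : Finset ι) (p : ι → R₁) (hp : ∀ i ∈ s, p i ∈ 𝔭)
    (n : ι → L) (hn : ∀ i ∈ s, IsIntegral R₁ (n i)) :
    IsIntegral O (∑ i ∈ s, (p i : L) * n i) := by
  classical
  induction s using Finset.induction_on with
  | empty => rw [Finset.sum_empty]; exact isIntegral_zero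
  | insert a s ha ih =>
    rw [Finset.sum_insert ha]
    exact (isIntegral_mul_of_mem hOR h𝔭 (hp a (Finset.mem_insert_self a s))
      (hn a (Finset.mem_insert_self a s))).add
      (ih (fun i hi => hp i (Finset.mem_insert_of_mem hi)) fun i hi => hn i (Finset.mem_insert_of_mem hi))

/-- **If `f ∈ O[X]` is monic of positive degree and `f(b)` is integral over `O`, then `b` is integral over
`O`**: `b` is a root of the monic polynomial `f − f(b)` over `O[f(b)]`, an integral extension of `O`.
[folklore] -/
theorem isIntegral_of_monic_of_aeval {A : Type u} [CommRing A] {S : Type u} [CommRing S] [Algebra A S]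
    {b : S} (f : A[X]) (hf : f.Monic) (hf0 : 0 < f.natDegree) (hc : IsIntegral A (aeval b f)) :
    IsIntegral A b := by
  rcases subsingleton_or_nontrivial S with hS | hS
  · rw [Subsingleton.elim b 0]; exact isIntegral_zero
  set c : S := aeval b f with hcdef
  let A' : Subalgebra A S := Algebra.adjoin A {c}
  haveI : Algebra.IsIntegral A A' :=
    Algebra.IsIntegral.adjoin fun x hx => by rw [Set.mem_singleton_iff.mp hx]; exact hc
  have hcA' : c ∈ A' := Algebra.subset_adjoin (Set.mem_singleton c)
  -- `b` is a root of the monic `f - c` over `A'`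
  have hb : IsIntegral A' b := by
    refine ⟨f.map (algebraMap A A') - C ⟨c, hcA'⟩, ?_, ?_⟩
    · refine (hf.map (algebraMap A A')).sub_of_left (degree_C_le.trans_lt ?_)
      rw [hf.degree_map]
      exact natDegree_pos_iff_degree_pos.mp hf0
    · change aeval b (f.map (algebraMap A A') - C (⟨c, hcA'⟩ : A')) = 0
      rw [map_sub, aeval_map_algebraMap, aeval_C, ← hcdef]
      exact sub_self c
  exact isIntegral_trans b hb

end Summit.ResolutionOfSingularities.ResolutionOfSingularities.Theorems.WildQuotientResolution.PinchingIntegral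

end
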